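/-
Copyright (c) 2026. All rights reserved.
Released under Apache 2.0 license as described in the file LICENSE.
Authors: HodgeCM publication cell (pub-hodgecm), GR lane, seat GR-1 (`pub-hodgecm-own-real34`).
-/
import Literature.NumberTheory.GelbartRogawski1991.DoubledUnitaryArchSiegelSignReps
import Literature.NumberTheory.Automorphic.UnitaryGroupArchSiegelSquaresReps
import HarnessLib

/-!
# `P_Δ(F ⊗ ℝ)` modulo squares is generated by the single and pair Levi sign representatives (list form)

Topic `NumberTheory/GelbartRogawski1991`; namespace `Literature.NumberTheory.GelbartRogawski1991.GRConstructionGen`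
(telescope of `DoubledUnitaryGlobalSplittingDataGen`).  KERNEL only: proved theorems; no definition, no named fact, no
`sorry`.  The generation binder `hgen` of `DoubledWeilRepresentationArchLiftSigns.exists_isArchHalf_twist_prod_signs` at the
doubled data: every `p ∈ U(J^𝔻)(F ⊗ ℝ)` with `(p, 1) ∈ P_Δ(𝔸)` is

  `p = (∏ᵢ qᵢ²) · ∏ⱼ rⱼ`, all `qᵢ ∈ P_Δ`, every `rⱼ` a SINGLE `mA (signPatternGL (mulSingle w_k ε))` or a PAIR
  `mA (signPatternGL (mulSingle w_k ε · mulSingle (c⁻¹w_k) ε))` representative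

(`UnitaryGroupArchSiegelSquaresReps.exists_list_sq_mul_levi_of_isSiegel_archToAdelic_of_base`: `p = (∏ qᵢ²) · q` with
`2 · e₂⁻¹ q e₂ = C · diag(r, τ⁻¹ (c⊗1)(r⁻¹)ᵀ τ) · C` for a sign pattern `r`; `UnitaryGroupArchSiegelLeviCayley`: `q = mA r` by
uniqueness; `UnitaryGroupArchSignPatterns`: `r = signPatternGL ρ = ∏ signPatternGL (mulSingle w ε)` over the real places `w`
with `ρ w = ε`, and a single at `c⁻¹ w_k` is `single k · pair k` up to a square).  Main statements: `exists_signReps_gen`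
(the Cayley–Levi homomorphism with ALL its properties: `P_Δ`, action on `Δ`, the `2 ·` matrix identity, the sign-character
values of `DoubledUnitaryArchSiegelSignReps`, AND the list generation), and its projection **`exists_signReps_hgen`**.

([Kudla1994, §3]; [HarrisKudlaSweet1996, §1 (1.11)–(1.12)]; [Artin1988, Chap. IV Thm. 4.7]; archimedean places of type (ii)
of [GelbartRogawski1991, Prop. 3.1.1].)  Written for the stage-1 cell `pub-hodgecm` (seat GR-1); nothing here is a claim
of the manuscripts adjudicated by that cell.

## References

* S. S. Kudla, Israel J. Math. 87 (1994) 361–401, §3 [Kudla1994].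
* M. Harris, S. S. Kudla, W. J. Sweet, J. Amer. Math. Soc. 9 (1996), §1 (1.11)–(1.12) [HarrisKudlaSweet1996].
* E. Artin, *Geometric Algebra*, Chap. IV Thm. 4.7 [Artin1988].
* S. Gelbart, J. Rogawski, Invent. Math. 105 (1991), §3.1 Prop. 3.1.1 p. 455 [GelbartRogawski1991].
-/

set_option autoImplicit false

noncomputable section

open scoped Classical
open scoped Matrix MatrixGroups
open NumberField NumberField.InfinitePlace NumberField.mixedEmbedding IsDedekindDomain
open Literature.NumberTheory.Automorphic Literature.NumberTheory.Automorphic.UnitaryGroup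
open Literature.NumberTheory.Weil1964
open Literature.NumberTheory.GaloisRepresentations
open Literature.RepresentationTheory.HeisenbergGroup
open Literature.NumberTheory.GelbartRogawski1991.UnitaryDualPair.ArchSplitting.QuadExt

namespace Literature.NumberTheory.GelbartRogawski1991.GRConstructionGen

open UnitaryDualPair

variable (F : Type) [Field F] [NumberField F] (E : Type) [Field E] [NumberField E] [Algebra F E]
  [Algebra.IsQuadraticExtension F E]
variable (c : E ≃ₐ[F] E) {δ : E} (hcδ : c δ = -δ) (hδ : δ ≠ 0) {d : F} (hd : δ * δ = algebraMap F E d)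
variable {N M n : ℕ} (e : Fin N × Fin M ≃ Fin n)
  (TV : Matrix (Fin N) (Fin N) F) (hV : TV.IsSymm) (hVd : IsUnit TV.det)
  (TW : Matrix (Fin M) (Fin M) F) (hW : TW.IsSymm) (hWd : IsUnit TW.det)

/-! ## §1 Generation from the `2 ·` matrix identity of the Cayley–Levi homomorphism -/

section Gen

variable {κ : Type*} (wOf : κ → {w : InfinitePlace E // w.IsReal}) (eκ : κ ⊕ κ ≃ {w : InfinitePlace E // w.IsReal})
  (he₁ : ∀ k, eκ (Sum.inl k) = wOf k) (he₂ : ∀ k, eκ (Sum.inr k) = ⟨c⁻¹ • (wOf k).1, isReal_smul_iff.mpr (wOf k).2⟩)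

omit [NumberField F] [NumberField E] [Algebra.IsQuadraticExtension F E] in
include he₁ he₂ in
/-- a one-place sign element at ANY real place is a product of singles and pairs: at `w_k` it is `single k`; at `c⁻¹ w_k`
it is `single k · pair k` (`single² = 1`). [cite: Artin1988, Chap. IV Thm. 4.7] -/
theorem exists_list_single_pair_of_mulSingle (ε : GL (Fin n) ℝ) (hε : ε * ε = 1) (w : {w : InfinitePlace E // w.IsReal}) :
    ∃ m : List (GL (Fin n) (mixedSpace E)),
      (∀ r ∈ m, (∃ k, r = signPatternGL E (Pi.mulSingle (wOf k) ε)) ∨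
        (∃ k, r = signPatternGL E (Pi.mulSingle (wOf k) ε *
          Pi.mulSingle (⟨c⁻¹ • (wOf k).1, isReal_smul_iff.mpr (wOf k).2⟩ : {w : InfinitePlace E // w.IsReal}) ε))) ∧
      m.prod = signPatternGL E (Pi.mulSingle w ε) := by
  obtain ⟨k, hk⟩ | ⟨k, hk⟩ : (∃ k, eκ (Sum.inl k) = w) ∨ (∃ k, eκ (Sum.inr k) = w) := by
    rcases h : eκ.symm w with k | k
    · exact Or.inl ⟨k, by rw [← h, Equiv.apply_symm_apply]⟩
    · exact Or.inr ⟨k, by rw [← h, Equiv.apply_symm_apply]⟩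
  · refine ⟨[signPatternGL E (Pi.mulSingle (wOf k) ε)], fun r hr => Or.inl ⟨k, by simpa using hr⟩, ?_⟩
    rw [List.prod_singleton, ← hk, he₁]
  · refine ⟨[signPatternGL E (Pi.mulSingle (wOf k) ε),
      signPatternGL E (Pi.mulSingle (wOf k) ε *
        Pi.mulSingle (⟨c⁻¹ • (wOf k).1, isReal_smul_iff.mpr (wOf k).2⟩ : {w : InfinitePlace E // w.IsReal}) ε)],
      fun r hr => ?_, ?_⟩
    · simp only [List.mem_cons, List.mem_nil_iff, or_false] at hr
      rcases hr with rfl | rfl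
      · exact Or.inl ⟨k, rfl⟩
      · exact Or.inr ⟨k, rfl⟩
    · rw [List.prod_cons, List.prod_singleton, signPatternGL_mul, ← mul_assoc, signPatternGL_mulSingle_mul_self E ε hε,
        one_mul, ← hk, he₂]

omit [Algebra.IsQuadraticExtension F E] in
include hV hW hVd hWd he₁ he₂ in
/-- **`P_Δ(F ⊗ ℝ) = ⟨squares of P_Δ⟩ · ⟨single, pair representatives⟩`, list form.**  For the Cayley–Levi homomorphism `mA`
with its `2 ·` matrix identity, every `p` with `(p, 1) ∈ P_Δ(𝔸)` is `(l.map (q ↦ q²)).prod * m.prod` with all `q ∈ l` in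
`P_Δ` and every element of `m` a single `mA (signPatternGL (mulSingle w_k ε))` or a pair
`mA (signPatternGL (mulSingle w_k ε · mulSingle (c⁻¹w_k) ε))` (`det ε < 0`, `ε² = 1`).
[cite: HarrisKudlaSweet1996, §1 (1.11)–(1.12)] [cite: Artin1988, Chap. IV Thm. 4.7] -/
theorem hgen_of_leviCayley (hc : ∀ x, c (c x) = x) (ε : GL (Fin n) ℝ)
    (hεdet : ((ε : GL (Fin n) ℝ) : Matrix (Fin n) (Fin n) ℝ).det < 0) (hε : ε * ε = 1) (hε1 : ε ≠ 1)
    (mA : GL (Fin n) (mixedSpace E) →* arch F E c (n + n) (hermD F E e TV TW))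
    (h2 : ∀ r, (2 : mixedSpace E) • Matrix.reindex (e₂ (n := n)).symm (e₂ (n := n)).symm
        (((mA r : arch F E c (n + n) (hermD F E e TV TW)) : GL (Fin (n + n)) (mixedSpace E)) :
          Matrix (Fin (n + n)) (Fin (n + n)) (mixedSpace E)) =
      Matrix.fromBlocks (1 : Matrix (Fin n) (Fin n) (mixedSpace E)) 1 1 (-1) *
        Matrix.fromBlocks (r : Matrix (Fin n) (Fin n) (mixedSpace E)) 0 0
          ((((gramR F e TV TW).map (algebraMap F E)).map (mixedEmbedding E) +
              ((gramR F e TV TW).map (algebraMap F E)).map (mixedEmbedding E))⁻¹ *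
            (((r⁻¹ : GL (Fin n) (mixedSpace E)) : Matrix (Fin n) (Fin n) (mixedSpace E)).map (conjMixed F E c))ᵀ *
            (((gramR F e TV TW).map (algebraMap F E)).map (mixedEmbedding E) +
              ((gramR F e TV TW).map (algebraMap F E)).map (mixedEmbedding E))) *
        Matrix.fromBlocks (1 : Matrix (Fin n) (Fin n) (mixedSpace E)) 1 1 (-1))
    (p : arch F E c (n + n) (hermD F E e TV TW))
    (hp : IsSiegelDelta F E c e TV TW (UnitaryGroup.archToAdelic F E c (n + n) (hermD F E e TV TW) p)) :
    ∃ (l m : List (arch F E c (n + n) (hermD F E e TV TW))),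
      (∀ q' ∈ l, IsSiegelDelta F E c e TV TW (UnitaryGroup.archToAdelic F E c (n + n) (hermD F E e TV TW) q')) ∧
      (∀ q ∈ m, q ∈ Set.range (fun k => mA (signPatternGL E (Pi.mulSingle (wOf k) ε *
          Pi.mulSingle (⟨c⁻¹ • (wOf k).1, isReal_smul_iff.mpr (wOf k).2⟩ : {w : InfinitePlace E // w.IsReal}) ε))) ∨
        q ∈ Set.range (fun k => mA (signPatternGL E (Pi.mulSingle (wOf k) ε)))) ∧
      p = (l.map fun q' => q' * q').prod * m.prod := by
  -- (1) `p = (∏ qᵢ²) · q`, `2 · e₂⁻¹ q e₂ = C · diag(r, …) · C`, `r` a sign pattern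
  have hTs : (gramR F e TV TW)ᵀ = gramR F e TV TW := by
    have hT : (gramR F e TV TW).IsSymm := by
      show (Matrix.reindex e e _).IsSymm
      exact (UnitaryGroup.isSymm_kronecker hV hW).submatrix _
    exact hT.eq
  have hTu : IsUnit (gramR F e TV TW).det := isUnit_det_gram F e hVd hWd
  have hJ : hermD F E e TV TW =
      (Matrix.reindex (e₂ (n := n)) (e₂ (n := n)) (Matrix.fromBlocks (gramR F e TV TW) 0 0 (-gramR F e TV TW))).map
        (algebraMap F E) := rfl
  obtain ⟨l, r, q, hl, hrR, hrC, hqP, hq2, hpq⟩ :=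
    UnitaryGroup.exists_list_sq_mul_levi_of_isSiegel_archToAdelic_of_base F E c (n + n) (hermD F E e TV TW) (e₂ (n := n))
      hc hTs hTu hJ (fun _ => ε) (fun _ => hεdet) p hp
  -- (2) `q = mA r`
  have hq : q = mA r := UnitaryGroup.eq_of_two_smul_reindex_eq F E c (n + n) (hermD F E e TV TW) (e₂ (n := n)) q (mA r)
    (by rw [hq2, h2])
  -- (3) `r = signPatternGL ρ`, `ρ w ∈ {1, ε}`; `ρ = ∏ mulSingle`
  set ρ : {w : InfinitePlace E // w.IsReal} → GL (Fin n) ℝ := fun w => Matrix.GeneralLinearGroup.map (evalR E w) r with hρ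
  have hrρ : r = signPatternGL E ρ := eq_signPatternGL E r ρ (fun w => rfl) hrC
  have hρval : ∀ w, ρ w = 1 ∨ ρ w = ε := fun w => hrR w
  obtain ⟨lw, -, -, hprod⟩ := exists_list_signPatternGL_mulSingle E ε hε1 ρ hρval
  -- (4) each one-place element is a product of singles and pairs
  have hsub : ∀ w : {w : InfinitePlace E // w.IsReal}, ∃ m : List (GL (Fin n) (mixedSpace E)),
      (∀ r' ∈ m, (∃ k, r' = signPatternGL E (Pi.mulSingle (wOf k) ε)) ∨
        (∃ k, r' = signPatternGL E (Pi.mulSingle (wOf k) ε *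
          Pi.mulSingle (⟨c⁻¹ • (wOf k).1, isReal_smul_iff.mpr (wOf k).2⟩ : {w : InfinitePlace E // w.IsReal}) ε))) ∧
      m.prod = signPatternGL E (Pi.mulSingle w ε) :=
    fun w => exists_list_single_pair_of_mulSingle F E c wOf eκ he₁ he₂ ε hε w
  choose mw hmw hmwprod using hsub
  set mGL : List (GL (Fin n) (mixedSpace E)) := (lw.map mw).flatten with hmGL
  have hmGLprod : mGL.prod = r := by
    rw [hmGL, List.prod_flatten, List.map_map, hrρ, ← hprod]
    congr 1
    exact List.map_congr_left fun w _ => hmwprod w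
  have hmGLmem : ∀ r' ∈ mGL, (∃ k, r' = signPatternGL E (Pi.mulSingle (wOf k) ε)) ∨
      (∃ k, r' = signPatternGL E (Pi.mulSingle (wOf k) ε *
        Pi.mulSingle (⟨c⁻¹ • (wOf k).1, isReal_smul_iff.mpr (wOf k).2⟩ : {w : InfinitePlace E // w.IsReal}) ε)) := by
    intro r' hr'
    rw [hmGL, List.mem_flatten] at hr'
    obtain ⟨ms, hms, hr'ms⟩ := hr'
    rw [List.mem_map] at hms
    obtain ⟨w, -, rfl⟩ := hms
    exact hmw w r' hr'ms
  -- (5) assemble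
  refine ⟨l, mGL.map mA, hl, fun q₀ hq₀ => ?_, ?_⟩
  · rw [List.mem_map] at hq₀
    obtain ⟨r', hr', rfl⟩ := hq₀
    rcases hmGLmem r' hr' with ⟨k, rfl⟩ | ⟨k, rfl⟩
    · exact Or.inr ⟨k, rfl⟩
    · exact Or.inl ⟨k, rfl⟩
  · rw [hpq, hq, ← hmGLprod, map_list_prod]

end Gen

/-! ## §2 The full package: the Cayley–Levi homomorphism with the sign values AND the generation -/

section Package

variable {κ : Type*} (wOf : κ → {w : InfinitePlace E // w.IsReal}) (eκ : κ ⊕ κ ≃ {w : InfinitePlace E // w.IsReal})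
  (he₁ : ∀ k, eκ (Sum.inl k) = wOf k) (he₂ : ∀ k, eκ (Sum.inr k) = ⟨c⁻¹ • (wOf k).1, isReal_smul_iff.mpr (wOf k).2⟩)

omit [Algebra.IsQuadraticExtension F E] in
include hV hW hVd hWd he₁ he₂ in
/-- **THE SIGN REPRESENTATIVES: `P_Δ`, action on `Δ`, sign characters, and generation.**  For an involution `c` and
`ε ∈ GL_n(ℝ)` with `det ε < 0`, `ε² = 1`, there is the Cayley–Levi homomorphism `mA : GL_n(E ⊗ ℝ) →* U(J^𝔻)(F ⊗ ℝ)` with: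
`(mA r, 1) ∈ P_Δ(𝔸)`; `archMat (deltaBlock (mA r, 1)) = r`; the sign characters `s_j = detSignAtR w_j` take the values
`s_j (q₁ k) = 1` (`j ≠ k`), `s_j (q₁ j) = −1`, `s_j (q₀ k) = 1` on the single `q₁ k = mA (signPatternGL (mulSingle w_k ε))` and pair
`q₀ k = mA (signPatternGL (mulSingle w_k ε · mulSingle (c⁻¹w_k) ε))` representatives; and every `p` with `(p,1) ∈ P_Δ(𝔸)` is a
product of squares of elements of `P_Δ` times a product of single and pair representatives.  (All binders about the
representatives of `DoubledWeilRepresentationArchLiftSigns.exists_isArchHalf_twist_prod_signs`; the `2 ·` matrix identity is exported for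
`DoubledUnitaryArchSiegelSignRepsDiagonal` / `DoubledWeilRepresentationArchTwistRealValues`.)
[cite: HarrisKudlaSweet1996, §1 (1.11)–(1.12)] [cite: Kudla1994, §3] [cite: Artin1988, Chap. IV Thm. 4.7] -/
theorem exists_signReps_gen (hc : ∀ x, c (c x) = x) (ε : GL (Fin n) ℝ)
    (hεdet : ((ε : GL (Fin n) ℝ) : Matrix (Fin n) (Fin n) ℝ).det < 0) (hε : ε * ε = 1) :
    ∃ mA : GL (Fin n) (mixedSpace E) →* arch F E c (n + n) (hermD F E e TV TW),
      (∀ r, IsSiegelDelta F E c e TV TW (UnitaryGroup.archToAdelic F E c (n + n) (hermD F E e TV TW) (mA r))) ∧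
      (∀ r, archMat E (Fin n) (deltaBlock F E c e TV TW (UnitaryGroup.archToAdelic F E c (n + n) (hermD F E e TV TW) (mA r))) =
        ((r : GL (Fin n) (mixedSpace E)) : Matrix (Fin n) (Fin n) (mixedSpace E))) ∧
      (∀ r, (2 : mixedSpace E) • Matrix.reindex (e₂ (n := n)).symm (e₂ (n := n)).symm
          (((mA r : arch F E c (n + n) (hermD F E e TV TW)) : GL (Fin (n + n)) (mixedSpace E)) :
            Matrix (Fin (n + n)) (Fin (n + n)) (mixedSpace E)) =
        Matrix.fromBlocks (1 : Matrix (Fin n) (Fin n) (mixedSpace E)) 1 1 (-1) *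
          Matrix.fromBlocks (r : Matrix (Fin n) (Fin n) (mixedSpace E)) 0 0
            ((((gramR F e TV TW).map (algebraMap F E)).map (mixedEmbedding E) +
                ((gramR F e TV TW).map (algebraMap F E)).map (mixedEmbedding E))⁻¹ *
              (((r⁻¹ : GL (Fin n) (mixedSpace E)) : Matrix (Fin n) (Fin n) (mixedSpace E)).map (conjMixed F E c))ᵀ *
              (((gramR F e TV TW).map (algebraMap F E)).map (mixedEmbedding E) +
                ((gramR F e TV TW).map (algebraMap F E)).map (mixedEmbedding E))) *
          Matrix.fromBlocks (1 : Matrix (Fin n) (Fin n) (mixedSpace E)) 1 1 (-1)) ∧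
      (∀ j k, j ≠ k → detSignAtR F E c (hermD F E e TV TW) (wOf j) (mA (signPatternGL E (Pi.mulSingle (wOf k) ε))) = 1) ∧
      (∀ j, ((detSignAtR F E c (hermD F E e TV TW) (wOf j) (mA (signPatternGL E (Pi.mulSingle (wOf j) ε))) : ℂˣ) : ℂ) = -1) ∧
      (∀ j k, detSignAtR F E c (hermD F E e TV TW) (wOf j)
        (mA (signPatternGL E (Pi.mulSingle (wOf k) ε *
          Pi.mulSingle (⟨c⁻¹ • (wOf k).1, isReal_smul_iff.mpr (wOf k).2⟩ : {w : InfinitePlace E // w.IsReal}) ε))) = 1) ∧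
      (∀ p : arch F E c (n + n) (hermD F E e TV TW),
        IsSiegelDelta F E c e TV TW (UnitaryGroup.archToAdelic F E c (n + n) (hermD F E e TV TW) p) →
        ∃ (l m : List (arch F E c (n + n) (hermD F E e TV TW))),
          (∀ q' ∈ l, IsSiegelDelta F E c e TV TW (UnitaryGroup.archToAdelic F E c (n + n) (hermD F E e TV TW) q')) ∧
          (∀ q ∈ m, q ∈ Set.range (fun k => mA (signPatternGL E (Pi.mulSingle (wOf k) ε *
              Pi.mulSingle (⟨c⁻¹ • (wOf k).1, isReal_smul_iff.mpr (wOf k).2⟩ : {w : InfinitePlace E // w.IsReal}) ε))) ∨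
            q ∈ Set.range (fun k => mA (signPatternGL E (Pi.mulSingle (wOf k) ε)))) ∧
          p = (l.map fun q' => q' * q').prod * m.prod) := by
  have hcc : c * c = 1 := AlgEquiv.ext fun y => by rw [AlgEquiv.mul_apply, hc]; rfl
  have hε1 : ε ≠ 1 := by
    rintro rfl
    rw [Units.val_one, Matrix.det_one] at hεdet
    exact absurd hεdet (not_lt.2 zero_le_one)
  have hTs : (gramR F e TV TW)ᵀ = gramR F e TV TW := by
    have hT : (gramR F e TV TW).IsSymm := by
      show (Matrix.reindex e e _).IsSymm
      exact (UnitaryGroup.isSymm_kronecker hV hW).submatrix _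
    exact hT.eq
  have hTu : IsUnit (gramR F e TV TW).det := isUnit_det_gram F e hVd hWd
  have hJ : hermD F E e TV TW =
      (Matrix.reindex (e₂ (n := n)) (e₂ (n := n)) (Matrix.fromBlocks (gramR F e TV TW) 0 0 (-gramR F e TV TW))).map
        (algebraMap F E) := rfl
  obtain ⟨mA, hP, h2, hΔ'⟩ := exists_leviCayleyHom_arch_of_base F E c (n + n) (hermD F E e TV TW) (e₂ (n := n)) hc hTs hTu hJ
  have hΔ : ∀ r, archMat E (Fin n) (deltaBlock F E c e TV TW (UnitaryGroup.archToAdelic F E c (n + n) (hermD F E e TV TW) (mA r))) =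
      ((r : GL (Fin n) (mixedSpace E)) : Matrix (Fin n) (Fin n) (mixedSpace E)) := fun r => by
    rw [archMat_deltaBlock_archToAdelic]; exact hΔ' r
  have hdet := det_evalR_leviCayley_signPattern F E c e TV hVd TW hWd hcc mA hP hΔ
  refine ⟨mA, hP, hΔ, h2, fun j k hjk => ?_, fun j => ?_, fun j k => ?_,
    fun p hp => hgen_of_leviCayley F E c e TV hV hVd TW hW hWd wOf eκ he₁ he₂ hc ε hεdet hε hε1 mA h2 p hp⟩
  · have h := hdet (Pi.mulSingle (wOf k) ε) (wOf j)
    obtain ⟨h1, h2'⟩ := single_apply F E c wOf eκ he₁ he₂ ε j k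
    rw [h1, h2', if_neg hjk, Units.val_one, Matrix.det_one, mul_one] at h
    exact Units.ext ((coe_detSignAtR_of_pos F E c _ (wOf j) _ (by rw [h]; exact one_pos)).trans Units.val_one.symm)
  · have h := hdet (Pi.mulSingle (wOf j) ε) (wOf j)
    obtain ⟨h1, h2'⟩ := single_apply F E c wOf eκ he₁ he₂ ε j j
    rw [h1, h2', if_pos rfl, Units.val_one, Matrix.det_one, mul_one] at h
    exact coe_detSignAtR_of_neg F E c _ (wOf j) _ (by rw [h]; exact hεdet)
  · have h := hdet (Pi.mulSingle (wOf k) ε *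
      Pi.mulSingle (⟨c⁻¹ • (wOf k).1, isReal_smul_iff.mpr (wOf k).2⟩ : {w : InfinitePlace E // w.IsReal}) ε) (wOf j)
    obtain ⟨h1, h2'⟩ := pair_apply F E c wOf eκ he₁ he₂ ε j k
    rw [h1, h2'] at h
    have hpos : 0 < ((((mA (signPatternGL E (Pi.mulSingle (wOf k) ε *
        Pi.mulSingle (⟨c⁻¹ • (wOf k).1, isReal_smul_iff.mpr (wOf k).2⟩ : {w : InfinitePlace E // w.IsReal}) ε)) :
          arch F E c (n + n) (hermD F E e TV TW)) : GL (Fin (n + n)) (mixedSpace E)) :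
          Matrix (Fin (n + n)) (Fin (n + n)) (mixedSpace E)).map (evalR E (wOf j))).det := by
      by_cases hjk : j = k
      · rw [if_pos hjk] at h
        have ha := mul_right_cancel₀ hεdet.ne (h.trans (one_mul _).symm)
        rw [ha]; exact one_pos
      · rw [if_neg hjk, Units.val_one, Matrix.det_one, mul_one] at h
        rw [h]; exact one_pos
    exact Units.ext ((coe_detSignAtR_of_pos F E c _ (wOf j) _ hpos).trans Units.val_one.symm)

end Package

end Literature.NumberTheory.GelbartRogawski1991.GRConstructionGen

end
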